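import Summits.Ventures.PercRepro.C041BlockMapFourCores
import Summits.Ventures.PercRepro.C041TriDomMonotoneInjection

/-!
# ROW C-041 — THE FIRST OPEN CORE ON SIX VERTICES IN THE KERNEL: `K₃,₃` with the marks on one side satisfies
CONJECTURE (STOCHASTIC DOMINATION) (p6, gen 48; P6-TWOEXIT-LEAN.md §53 ADDENDUM 22 cont. 7)

`k33`: the marks `0, 1, 2` on one side, the unmarked `3, 4, 5` on the other, the nine edges; `T = 61`, `A = (6, 6, 6)`
(ADDENDUM 20: the first core after the one-far-mark 2-cut rule).  The eighteen crossed colourings are decided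
(`cycCrossed_k33`, `512` decides in `≤ 5` steps), the red-ward injection `φ33` into `(⊤,⊥)` is exhibited, and
`cycDomination_iff_injection` gives `cycDomination_k33`.
-/

namespace PercRepro

namespace ZoneZ

namespace MultiExit

open ZoneData Pendant Finset

/-- A colouring of nine edges is the vector of its values. -/
theorem fin9_eta_k33 (ω : Fin 9 → Bool) : ω = ![ω 0, ω 1, ω 2, ω 3, ω 4, ω 5, ω 6, ω 7, ω 8] := by
  funext i
  fin_cases i <;> rfl

/-- `K₃,₃` with the marks `0, 1, 2` on one side: the edges `i–(3 + j)` for `i, j < 3`, listed as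
`0–3, 0–4, 0–5, 1–3, 1–4, 1–5, 2–3, 2–4, 2–5`. -/
def k33 : ZoneData (Fin 6) (Fin 9) Empty Empty where
  fst := ![0, 0, 0, 1, 1, 1, 2, 2, 2]
  snd := ![3, 4, 5, 3, 4, 5, 3, 4, 5]
  at₁ := Empty.elim
  at₂ := Empty.elim

set_option synthInstance.maxSize 800000 in
set_option synthInstance.maxHeartbeats 800000 in
set_option maxHeartbeats 64000000 in
/-- **The crossed colourings of `K₃,₃`**: exactly eighteen (six in each cyclic class). -/
theorem cycCrossed_k33 (b : Fin 9 → Bool) : CycCrossed k33 0 1 2 b ↔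
    b = ![true, false, false, true, true, true, false, false, false] ∨
    b = ![false, true, false, true, true, true, false, false, false] ∨
    b = ![true, true, false, true, true, true, false, false, false] ∨
    b = ![false, false, true, true, true, true, false, false, false] ∨
    b = ![true, false, true, true, true, true, false, false, false] ∨
    b = ![false, true, true, true, true, true, false, false, false] ∨
    b = ![true, true, true, false, false, false, true, false, false] ∨
    b = ![true, true, true, false, false, false, false, true, false] ∨
    b = ![true, true, true, false, false, false, true, true, false] ∨
    b = ![true, true, true, false, false, false, false, false, true] ∨
    b = ![true, true, true, false, false, false, true, false, true] ∨
    b = ![true, true, true, false, false, false, false, true, true] ∨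
    b = ![false, false, false, true, false, false, true, true, true] ∨
    b = ![false, false, false, false, true, false, true, true, true] ∨
    b = ![false, false, false, true, true, false, true, true, true] ∨
    b = ![false, false, false, false, false, true, true, true, true] ∨
    b = ![false, false, false, true, false, true, true, true, true] ∨
    b = ![false, false, false, false, true, true, true, true, true] := by
  unfold CycCrossed
  simp only [rsig, bsig, RdS_free, MgS_free, Prod.mk.injEq, decide_eq_true_eq, decide_eq_false_iff_not,
    Rd_iff_conn k33 (k := 5) (by simp), Mg_iff_conn k33 (k := 5) (by simp)]
  rw [fin9_eta_k33 b]
  generalize b 0 = b0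
  generalize b 1 = b1
  generalize b 2 = b2
  generalize b 3 = b3
  generalize b 4 = b4
  generalize b 5 = b5
  generalize b 6 = b6
  generalize b 7 = b7
  generalize b 8 = b8
  simp only [Conn]
  unfold cAdj ZoneData.Joins
  cases b0 <;> cases b1 <;> cases b2 <;> cases b3 <;> cases b4 <;> cases b5 <;> cases b6 <;> cases b7 <;> cases b8 <;> decide

set_option synthInstance.maxSize 800000 in
set_option synthInstance.maxHeartbeats 800000 in
set_option maxHeartbeats 64000000 in
/-- The eighteen images of the injection lie in `(⊤,⊥)`. -/
theorem topBot_k33_img :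
    TopBot k33 0 1 2 ![true, false, true, true, true, true, true, true, false] ∧
    TopBot k33 0 1 2 ![true, true, true, true, true, true, true, false, false] ∧
    TopBot k33 0 1 2 ![true, true, true, true, true, true, true, true, false] ∧
    TopBot k33 0 1 2 ![true, true, true, true, true, true, false, true, false] ∧
    TopBot k33 0 1 2 ![true, false, true, true, true, true, false, true, false] ∧
    TopBot k33 0 1 2 ![false, true, true, true, true, true, true, false, false] ∧
    TopBot k33 0 1 2 ![true, true, true, false, true, true, true, false, false] ∧
    TopBot k33 0 1 2 ![true, true, true, true, false, true, false, true, false] ∧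
    TopBot k33 0 1 2 ![true, true, true, false, false, true, true, true, false] ∧
    TopBot k33 0 1 2 ![true, true, true, true, true, false, false, false, true] ∧
    TopBot k33 0 1 2 ![true, true, true, false, true, false, true, false, true] ∧
    TopBot k33 0 1 2 ![true, true, true, true, false, false, false, true, true] ∧
    TopBot k33 0 1 2 ![false, true, true, true, false, false, true, true, true] ∧
    TopBot k33 0 1 2 ![true, false, true, false, true, false, true, true, true] ∧
    TopBot k33 0 1 2 ![false, false, true, true, true, false, true, true, true] ∧
    TopBot k33 0 1 2 ![true, true, false, false, false, true, true, true, true] ∧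
    TopBot k33 0 1 2 ![false, true, false, true, false, true, true, true, true] ∧
    TopBot k33 0 1 2 ![true, false, false, false, true, true, true, true, true] := by
  unfold TopBot
  simp only [rsig, bsig, RdS_free, MgS_free, Prod.mk.injEq, decide_eq_true_eq, decide_eq_false_iff_not,
    Rd_iff_conn k33 (k := 5) (by simp), Mg_iff_conn k33 (k := 5) (by simp)]
  simp only [Conn]
  unfold cAdj ZoneData.Joins
  decide

/-- The red-ward injection of the eighteen crossed colourings into `(⊤,⊥)`. -/
def φ33 (b : Fin 9 → Bool) : Fin 9 → Bool :=
  if b = ![true, false, false, true, true, true, false, false, false] then ![true, false, true, true, true, true, true, true, false]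
  else if b = ![false, true, false, true, true, true, false, false, false] then ![true, true, true, true, true, true, true, false, false]
  else if b = ![true, true, false, true, true, true, false, false, false] then ![true, true, true, true, true, true, true, true, false]
  else if b = ![false, false, true, true, true, true, false, false, false] then ![true, true, true, true, true, true, false, true, false]
  else if b = ![true, false, true, true, true, true, false, false, false] then ![true, false, true, true, true, true, false, true, false]
  else if b = ![false, true, true, true, true, true, false, false, false] then ![false, true, true, true, true, true, true, false, false]
  else if b = ![true, true, true, false, false, false, true, false, false] then ![true, true, true, false, true, true, true, false, false]
  else if b = ![true, true, true, false, false, false, false, true, false] then ![true, true, true, true, false, true, false, true, false]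
  else if b = ![true, true, true, false, false, false, true, true, false] then ![true, true, true, false, false, true, true, true, false]
  else if b = ![true, true, true, false, false, false, false, false, true] then ![true, true, true, true, true, false, false, false, true]
  else if b = ![true, true, true, false, false, false, true, false, true] then ![true, true, true, false, true, false, true, false, true]
  else if b = ![true, true, true, false, false, false, false, true, true] then ![true, true, true, true, false, false, false, true, true]
  else if b = ![false, false, false, true, false, false, true, true, true] then ![false, true, true, true, false, false, true, true, true]
  else if b = ![false, false, false, false, true, false, true, true, true] then ![true, false, true, false, true, false, true, true, true]
  else if b = ![false, false, false, true, true, false, true, true, true] then ![false, false, true, true, true, false, true, true, true]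
  else if b = ![false, false, false, false, false, true, true, true, true] then ![true, true, false, false, false, true, true, true, true]
  else if b = ![false, false, false, true, false, true, true, true, true] then ![false, true, false, true, false, true, true, true, true]
  else if b = ![false, false, false, false, true, true, true, true, true] then ![true, false, false, false, true, true, true, true, true]
  else b

/-- The eighteen crossed colourings, as a list. -/
def crossed33 : List (Fin 9 → Bool) :=
  [![true, false, false, true, true, true, false, false, false],
    ![false, true, false, true, true, true, false, false, false],
    ![true, true, false, true, true, true, false, false, false],
    ![false, false, true, true, true, true, false, false, false],
    ![true, false, true, true, true, true, false, false, false],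
    ![false, true, true, true, true, true, false, false, false],
    ![true, true, true, false, false, false, true, false, false],
    ![true, true, true, false, false, false, false, true, false],
    ![true, true, true, false, false, false, true, true, false],
    ![true, true, true, false, false, false, false, false, true],
    ![true, true, true, false, false, false, true, false, true],
    ![true, true, true, false, false, false, false, true, true],
    ![false, false, false, true, false, false, true, true, true],
    ![false, false, false, false, true, false, true, true, true],
    ![false, false, false, true, true, false, true, true, true],
    ![false, false, false, false, false, true, true, true, true],
    ![false, false, false, true, false, true, true, true, true],
    ![false, false, false, false, true, true, true, true, true]]

set_option maxRecDepth 100000 in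
/-- The injection is injective on the crossed colourings. -/
theorem φ33_inj : ∀ ω ∈ crossed33, ∀ ω' ∈ crossed33, φ33 ω = φ33 ω' → ω = ω' := by
  decide

set_option maxRecDepth 100000 in
/-- The injection only turns blue edges red. -/
theorem φ33_le : ∀ ω ∈ crossed33, LeCol ω (φ33 ω) := by
  unfold LeCol
  decide

set_option maxRecDepth 100000 in
/-- The images of the eighteen crossed colourings. -/
theorem φ33_vals :
    φ33 ![true, false, false, true, true, true, false, false, false] = ![true, false, true, true, true, true, true, true, false] ∧
    φ33 ![false, true, false, true, true, true, false, false, false] = ![true, true, true, true, true, true, true, false, false] ∧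
    φ33 ![true, true, false, true, true, true, false, false, false] = ![true, true, true, true, true, true, true, true, false] ∧
    φ33 ![false, false, true, true, true, true, false, false, false] = ![true, true, true, true, true, true, false, true, false] ∧
    φ33 ![true, false, true, true, true, true, false, false, false] = ![true, false, true, true, true, true, false, true, false] ∧
    φ33 ![false, true, true, true, true, true, false, false, false] = ![false, true, true, true, true, true, true, false, false] ∧
    φ33 ![true, true, true, false, false, false, true, false, false] = ![true, true, true, false, true, true, true, false, false] ∧
    φ33 ![true, true, true, false, false, false, false, true, false] = ![true, true, true, true, false, true, false, true, false] ∧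
    φ33 ![true, true, true, false, false, false, true, true, false] = ![true, true, true, false, false, true, true, true, false] ∧
    φ33 ![true, true, true, false, false, false, false, false, true] = ![true, true, true, true, true, false, false, false, true] ∧
    φ33 ![true, true, true, false, false, false, true, false, true] = ![true, true, true, false, true, false, true, false, true] ∧
    φ33 ![true, true, true, false, false, false, false, true, true] = ![true, true, true, true, false, false, false, true, true] ∧
    φ33 ![false, false, false, true, false, false, true, true, true] = ![false, true, true, true, false, false, true, true, true] ∧
    φ33 ![false, false, false, false, true, false, true, true, true] = ![true, false, true, false, true, false, true, true, true] ∧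
    φ33 ![false, false, false, true, true, false, true, true, true] = ![false, false, true, true, true, false, true, true, true] ∧
    φ33 ![false, false, false, false, false, true, true, true, true] = ![true, true, false, false, false, true, true, true, true] ∧
    φ33 ![false, false, false, true, false, true, true, true, true] = ![false, true, false, true, false, true, true, true, true] ∧
    φ33 ![false, false, false, false, true, true, true, true, true] = ![true, false, false, false, true, true, true, true, true] := by
  decide

/-- A crossed colouring is in the list. -/
theorem mem_crossed33 {b : Fin 9 → Bool} (h : CycCrossed k33 0 1 2 b) : b ∈ crossed33 := by
  rw [cycCrossed_k33] at h
  simp only [crossed33, List.mem_cons, List.mem_nil_iff, or_false]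
  exact h

open Classical in
/-- **THEOREM (`K₃,₃` SATISFIES THE CONJECTURE)**: on every up-set of colourings of `K₃,₃` with the marks on one side,
the cyclic crossed classes are outnumbered by `(⊤,⊥)`. -/
theorem cycDomination_k33 : CycDomination k33 0 1 2 := by
  rw [cycDomination_iff_injection]
  refine ⟨φ33, ?_, ?_⟩
  · intro ω hω ω' hω' heq
    exact φ33_inj ω (mem_crossed33 hω) ω' (mem_crossed33 hω') heq
  · intro ω hω
    refine ⟨?_, φ33_le ω (mem_crossed33 hω)⟩
    rw [cycCrossed_k33] at hω
    obtain ⟨h1, h2, h3, h4, h5, h6, h7, h8, h9, h10, h11, h12, h13, h14, h15, h16, h17, h18⟩ := topBot_k33_img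
    obtain ⟨v1, v2, v3, v4, v5, v6, v7, v8, v9, v10, v11, v12, v13, v14, v15, v16, v17, v18⟩ := φ33_vals
    rcases hω with rfl | rfl | rfl | rfl | rfl | rfl | rfl | rfl | rfl | rfl | rfl | rfl | rfl | rfl | rfl | rfl | rfl | rfl
    · rw [v1]; exact h1
    · rw [v2]; exact h2
    · rw [v3]; exact h3
    · rw [v4]; exact h4
    · rw [v5]; exact h5
    · rw [v6]; exact h6
    · rw [v7]; exact h7
    · rw [v8]; exact h8
    · rw [v9]; exact h9
    · rw [v10]; exact h10
    · rw [v11]; exact h11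
    · rw [v12]; exact h12
    · rw [v13]; exact h13
    · rw [v14]; exact h14
    · rw [v15]; exact h15
    · rw [v16]; exact h16
    · rw [v17]; exact h17
    · rw [v18]; exact h18

end MultiExit

end ZoneZ

end PercRepro
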